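import Literature.NumberTheory.Automorphic.PairLFunctionMeromorphicContinuation
import Literature.NumberTheory.Automorphic.PairLFunctionPolesRankNeGodementJacquet
import Literature.NumberTheory.Automorphic.StrongMultiplicityOneSphericalProofs
import Literature.NumberTheory.Automorphic.StrongMultiplicityOneLevel
import Literature.NumberTheory.Automorphic.SatakeParameterBoundHolds
import Literature.NumberTheory.Automorphic.AutomorphicLFunctions
import Literature.NumberTheory.Automorphic.PairLFunctionMeromorphicContinuationProofs
import Literature.NumberTheory.Automorphic.PairLFunctionPolesRankNeLandau
import Literature.NumberTheory.Automorphic.PairLFunctionBoundarySelfDual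
import HarnessLib

/-!
# Mœglin–Waldspurger, Corollaire (i)(a) for `GL_n × GL_1` and `GL_1 × GL_n` from Godement–Jacquet
(proofs only)

Topic `NumberTheory/Automorphic`; namespace `Literature.NumberTheory.Automorphic`. Proof file
(theorems only: no definition, no named fact, no instance), sibling of
`PairLFunctionMeromorphicContinuation`, under its named fact
`MoeglinWaldspurger1989_partialPairL_entire_of_rank_ne` — C. Mœglin, J.-L. Waldspurger, *Le spectre
résiduel de `GL(n)`*, Ann. Sci. ÉNS (4) 22 (1989), Appendice, Corollaire (i)(a), p. 667 (PDF p. 64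
of the held copy doi:10.24033/asens.1595): for unitary cuspidal `ρ`, `ρ'` on `GL(n, 𝔸)`,
`GL(n', 𝔸)` with `n ≠ n'`, "`L(s, ρ × ρ')` est entière"; in the tree's rendering for the partial
`L`-function, `L^S(s, π ⊗ σ) = partialPairL S α β s` extends to an entire function.

This file proves the fact **in the case where one member has rank one**, i.e. for the pairs
`(π, χ)` and `(χ, π)` of a cuspidal `π` of `GL_n(𝔸_K)`, `n ≥ 2`, and an idele class character
`χ` (a cuspidal automorphic representation of `GL_1(𝔸_K)`), **from the named fact
`godementJacquet` of `AutomorphicLFunctions` at `GL_n`** (lang.S21; Godement–Jacquet, LNM 260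
(1972), Thm. 13.8: for cuspidal `Π` of `GL_n`, `n ≥ 2`, `L(s, Π)` extends to an entire function —
here for `Π = π ⊗ χ`) and nothing else. In print this is the remark that for `n' = 1` the
Rankin–Selberg `L`-function `L(s, ρ × χ)` is the standard (Godement–Jacquet) `L`-function
`L(s, ρ ⊗ χ)` of the twist (Jacquet–Piatetski-Shapiro–Shalika (1983), §(0.2); Cogdell (2004),
§3.1: "for `m = 1` … the local integrals … are those of Godement–Jacquet up to a shift"; for the
unramified factors this is the identity `det(1 - t_{π,v} ⊗ χ(ϖ_v) q_v^{-s}) = det(1 - t_{π ⊗ χ, v} q_v^{-s})`,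
Arthur–Clozel (1989), Ch. 3, p. 172).

Contents (all proved):

* `HeckeCharacter.exists_level_not_dvd_of_isUnramifiedAt` — **a Hecke character has a level prime
  to any place where it is unramified**: if `χ` is unramified at `v` then for every `n` there is
  a non-zero ideal `𝔪` with `v ∤ 𝔪` and `χ (det k) = 1` for all `k` in the principal congruence
  subgroup `K(𝔪) ≤ GL_n(𝔸_K)` (levels prime to `v` up to the local spherical factor,
  `exists_principalCongruenceLevel_not_dvd_mul_ofLocal_inv_mem`; `χ(det ι_v(k_v)) = χ_v(det k_v) = 1`
  since `det k_v ∈ 𝒪_vˣ`; Tate's "no small subgroups", `eq_one_of_norm_pow_sub_one_le`). This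
  refines `HeckeCharacter.exists_level` of `PairLFunctionPolesRankNeTwist`;
* `IsSatakeFamilyOf.twistByChar_of_isUnramifiedAt` — **the Satake family of `π ⊗ χ` off `S` is
  `v ↦ χ(ϖ_v) t_{π,v}` as soon as `χ` is unramified off `S`** (no global level hypothesis:
  `IsSatakeFamilyOf.twistByChar` place by place with the levels of the previous item);
* `StandardLFunctionData.hasEntireContinuation_partialStandardL`,
  `hasEntireContinuation_partialStandardL_of_godementJacquet` — **partial standard `L`-functions
  are entire when `L(s, Π)` is**: if the full `L`-function `D.L` of a
  standard `L`-function datum of the cuspidal `Π` agrees on `Re s > 1` with an entire function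
  (`HasEntireContinuation`, as delivered by `godementJacquet`), then so does `L^S(s, γ)` for every
  finite `S` and every honest Satake family `γ` of `Π` off `S`: `D.S ⊆ S` (the datum's exceptional
  places are genuinely ramified), `L^S(γ) = g · ∏_{v ∈ D.S} P_v(q_v^{-s}) · ∏_{v ∈ S ∖ D.S} det(1 - t_v q_v^{-s})`
  off the isolated zeros of the entire, not identically vanishing finite product
  (`L_eq_partialStandardL_mul_of_summable`, Jacquet–Shalika's (5.3.3)
  `summable_normSq_trace_satakePow_holds`), and the two sides are continuous on `Re s > 1`
  (`differentiableOn_partialStandardL_of_summable`);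
* `MoeglinWaldspurger1989_partialPairL_entire_of_rank_ne_gl_one_of_godementJacquet` (**main**) —
  the named fact at `(n, 1)`, `n ≥ 2`, from `godementJacquet` at `GL_n`:
  `L^S(s, π ⊗ χ) = L^S(s, π ⊗ χ)` (`partialPairL_eq_partialStandardL_twist`) for the twist
  `π ⊗ χ = CuspidalAutomorphicRepGL.twistByChar`, whose Satake family off `S` is honest by the
  second item (`χ = χ_{σ}` is unramified off `S`, `IsSatakeFamilyOf.isUnramifiedAt_heckeCharacter`);
  `…_one_gl_of_godementJacquet` — the named fact at `(1, n)` (`partialPairL_comm`);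
  `…_two_one_of_godementJacquet`, `…_one_two_of_godementJacquet` — `GL₂ × GL₁`, `GL₁ × GL₂`;
* `JacquetShalika1981_partialPairL_at_one_of_rank_ne_gl_one_of_godementJacquet_of_MW` (and
  `…_one_gl_…`) — **Arthur–Clozel (2.2) at `s = 1` for `GL_n × GL_1` from `godementJacquet` at
  `GL_n` and Corollaire (ii) at `GL_n`** (`…_of_moeglinWaldspurger` of `PairLFunctionPolesRankNeLandau`:
  de la Vallée Poussin with Landau's lemma; Corollaire (ii) at `GL_1` is the theorem
  `MoeglinWaldspurger1989_partialPairL_of_eq_conj_one`);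
  `JacquetShalika1981_partialPairL_boundary_of_ne_one_gl_one_of_godementJacquet_of_MW` (and
  `…_one_gl_…`) — **(2.2) off `s = 1` for `GL_n × GL_1`** from `godementJacquet`, Corollaire (i)(b),
  (ii) and multiplicity one at `GL_n` (`…_of_MW_of_rank_one` of `PairLFunctionBoundarySelfDual`);
* `exists_cuspidalAutomorphicRepGL_one_isSatakeFamilyOf_one`,
  `MoeglinWaldspurger1989_partialPairL_entire_of_rank_ne_gl_one_of_standard`,
  `hasEntireContinuation_partialStandardL_of_MW_rank_ne_gl_one`,
  `MoeglinWaldspurger1989_partialPairL_entire_of_rank_ne_gl_one_iff_standard` — **the `(n, 1)` slice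
  of the named fact is equivalent to the entireness of all partial standard `L`-functions of
  cuspidal representations of `GL_n(𝔸_K)`** (`n ≥ 2`): pair `Π` with the trivial representation
  `𝟙` of `GL_1(𝔸_K)` (honest Satake family `{1}` off `∅`), `L^S(s, Π × 𝟙) = L^S(s, Π)`.

What is NOT here: `godementJacquet` itself (the entire continuation of standard `L`-functions of
cuspidal representations of `GL_n`, `n ≥ 2`), and the case `n, m ≥ 2` of Corollaire (i)(a) (the
`GL_n × GL_m` Rankin–Selberg theory).

## References

* C. Mœglin, J.-L. Waldspurger, *Le spectre résiduel de `GL(n)`*, Ann. Sci. École Norm. Sup. (4)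
  22 (1989), 605–674: Appendice, Corollaire (i)(a), p. 667. [MoeglinWaldspurger1989]
* R. Godement, H. Jacquet, *Zeta functions of simple algebras*, LNM 260 (1972), Thm. 13.8.
  [GodementJacquet1972]
* J. W. Cogdell, *Analytic theory of `L`-functions for `GL_n`*, in: An Introduction to the
  Langlands Program (Birkhäuser, 2004), §3.1, Thm. 4.2. [CogdellAnalyticTheory2004]
* J. Arthur, L. Clozel, *Simple algebras, base change, and the advanced theory of the trace
  formula*, Ann. of Math. Stud. 120 (1989), Ch. 3, p. 172 (`t_{π ⊗ η, v} = η(ϖ_v) t_{π,v}`).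
  [ArthurClozelAMS120]
* J. Tate, *Fourier analysis in number fields and Hecke's zeta-functions* (1950), in
  Cassels–Fröhlich (1967), Ch. XV, Lemma 3.2.1. [TateThesis1967]
-/

noncomputable section

open scoped MatrixGroups Topology
open NumberField IsDedekindDomain MeasureTheory Filter Complex Set

/-! ### A Hecke character has a level prime to every unramified place -/

namespace Literature.NumberTheory.GaloisRepresentations.HeckeCharacter

open Literature.NumberTheory.Automorphic

variable {K : Type} [Field K] [NumberField K]

/-- **A level prime to an unramified place.** If the Hecke character `χ` of `K` is unramified at
the finite place `v`, then for every `n` there is a non-zero ideal `𝔪 ⊆ 𝓞 K` **prime to `v`**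
with `χ (det k) = 1` for all `k` in the principal congruence subgroup `K(𝔪) ≤ GL_n(𝔸_K)`. Proof:
the open set `U = {g : |χ(det g) - 1| < 1/2}` is a neighbourhood of `1`; by
`exists_principalCongruenceLevel_not_dvd_mul_ofLocal_inv_mem` there is `𝔪 ≠ 0` prime to `v` with
`k ι_v(k_v)⁻¹ ∈ U` for all `k ∈ K(𝔪)`; since `det ι_v(k_v) = ⟨det k_v⟩_v` with `det k_v ∈ 𝒪_vˣ`
(`valued_det_eq_one_of_mem_valuedCongruenceSubgroup`) and `χ` is unramified at `v`,
`χ(det k) = χ(det (k ι_v(k_v)⁻¹))` lies within `1/2` of `1` for every `k ∈ K(𝔪)`, hence so do all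
its powers, forcing `χ(det k) = 1` (Tate's Lemma 3.2.1, `eq_one_of_norm_pow_sub_one_le`).
[cite: TateThesis1967, Ch. XV, Lemma 3.2.1] -/
theorem exists_level_not_dvd_of_isUnramifiedAt (n : ℕ) {χ : HeckeCharacter K}
    {v : HeightOneSpectrum (𝓞 K)} (hv : χ.IsUnramifiedAt v) :
    ∃ 𝔪 : Ideal (𝓞 K), 𝔪 ≠ 0 ∧ ¬ v.asIdeal ∣ 𝔪 ∧
      ∀ k ∈ principalCongruenceLevel n K 𝔪, χ (Matrix.GeneralLinearGroup.det k) = 1 := by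
  set V : Set (ideleGroup K) := {x | ‖((χ x : ℂˣ) : ℂ) - 1‖ < 1 / 2} with hV
  have hcont : Continuous fun x : ideleGroup K => ‖((χ x : ℂˣ) : ℂ) - 1‖ :=
    ((Units.continuous_val.comp (map_continuous χ)).sub continuous_const).norm
  have hVopen : IsOpen V := isOpen_lt hcont continuous_const
  have hV1 : (1 : ideleGroup K) ∈ V := by
    simp only [hV, Set.mem_setOf_eq, map_one, Units.val_one, sub_self, norm_zero]
    norm_num
  have hU : (Matrix.GeneralLinearGroup.det : GL (Fin n) (AdeleRing (𝓞 K) K) →* ideleGroup K) ⁻¹' V ∈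
      𝓝 (1 : GL (Fin n) (AdeleRing (𝓞 K) K)) :=
    Matrix.GeneralLinearGroup.continuous_det.continuousAt.preimage_mem_nhds
      (by rw [map_one]; exact hVopen.mem_nhds hV1)
  obtain ⟨𝔪, h𝔪, hv𝔪, hsub⟩ :=
    exists_principalCongruenceLevel_not_dvd_mul_ofLocal_inv_mem n K v hU
  refine ⟨𝔪, h𝔪, hv𝔪, fun k hk => ?_⟩
  -- `χ (det ι_v(k'_v)) = 1` for every `k' ∈ K(𝔪)`: `det k'_v ∈ 𝒪_vˣ` and `χ` is unramified at `v`
  have hloc : ∀ k' ∈ principalCongruenceLevel n K 𝔪,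
      χ (Matrix.GeneralLinearGroup.det
        (GLn.ofLocal n K v ((AdelicGroupData.gl n K).toLocal v k'))) = 1 := fun k' hk' => by
    rw [GLn.det_ofLocal]
    exact hv.map_localUnits_eq_one _ (valued_det_eq_one_of_mem_valuedCongruenceSubgroup
      (toLocal_mem_valuedCongruenceSubgroup_one (principalCongruenceLevel_le n K 𝔪 hk') v))
  -- all powers of `χ (det k)` lie within `1/2` of `1`
  have hpow : ∀ j : ℕ, ‖((χ (Matrix.GeneralLinearGroup.det k) : ℂˣ) : ℂ) ^ j - 1‖ ≤ 1 / 2 := by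
    intro j
    have hkj : k ^ j ∈ principalCongruenceLevel n K 𝔪 := pow_mem hk j
    have h1 := hsub _ hkj
    simp only [Set.mem_preimage, hV, Set.mem_setOf_eq, map_mul, map_inv] at h1
    rw [hloc _ hkj, inv_one, mul_one, map_pow, map_pow, Units.val_pow_eq_pow_val] at h1
    exact h1.le
  have hz := eq_one_of_norm_pow_sub_one_le (by norm_num : (1 / 2 : ℝ) < 1) hpow
  exact Units.val_eq_one.mp hz

end Literature.NumberTheory.GaloisRepresentations.HeckeCharacter

namespace Literature.NumberTheory.Automorphic

open AdelicGroupData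

/-! ### The Satake family of `π ⊗ χ` off `S`, for `χ` unramified off `S` -/

section Twist

variable {n : ℕ} {K : Type} [Field K] [NumberField K]
  {μ : Measure (gl n K).automorphicQuotient} [(gl n K).IsAutomorphicMeasure μ]

/-- **The Satake family of `π ⊗ χ` is `v ↦ χ(ϖ_v) t_{π,v}` off `S`, for `χ` unramified off `S`**
(Arthur–Clozel (1989), Ch. 3, p. 172: `t_{π ⊗ η, v} = η(ϖ_v) t_{π,v}`). Compared with
`IsSatakeFamilyOf.twistByChar` no global level of `χ` supported inside `S` is required: at each
`v ∉ S` one uses a level of `χ` prime to `v` (`HeckeCharacter.exists_level_not_dvd_of_isUnramifiedAt`).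
[cite: ArthurClozelAMS120, Ch. 3, proof of Thm. 3.1 (p. 172)] -/
theorem IsSatakeFamilyOf.twistByChar_of_isUnramifiedAt {P : CuspidalAutomorphicRepGL n K μ}
    {S : Set (HeightOneSpectrum (𝓞 K))} {α : SatakeFamily K} (hα : IsSatakeFamilyOf P S α)
    (χ : Literature.NumberTheory.GaloisRepresentations.HeckeCharacter K) (hχ : χ.IsUnitary)
    (hχ₀ : ∀ t, χ (posRealIdele K t) = 1) (hur : ∀ v ∉ S, χ.IsUnramifiedAt v) :
    IsSatakeFamilyOf (P.twistByChar χ hχ hχ₀) S fun v => (α v).map (χ.valueAtUniformizer v * ·) := by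
  intro v hv
  obtain ⟨𝔪, h𝔪, hv𝔪, hχ𝔪⟩ :=
    Literature.NumberTheory.GaloisRepresentations.HeckeCharacter.exists_level_not_dvd_of_isUnramifiedAt
      n (hur v hv)
  have hα' : IsSatakeFamilyOf P (S ∪ {w | w.asIdeal ∣ 𝔪}) α := hα.mono subset_union_left
  have h := hα'.twistByChar χ hχ hχ₀ h𝔪 hχ𝔪 (fun w hw hdvd => hw (Or.inr hdvd))
  exact h v (fun h' => h'.elim hv hv𝔪)

end Twist

/-! ### Partial standard `L`-functions are entire when `L(s, Π)` is -/

section Standard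

variable {n : ℕ} {K : Type} [Field K] [NumberField K]
  {μ : Measure (gl n K).automorphicQuotient} [(gl n K).IsAutomorphicMeasure μ]

/-- **An entire continuation of `L(s, Π)` gives one of every partial standard `L`-function.** Let
`D` be a standard `L`-function datum of the cuspidal `Π` of `GL_n(𝔸_K)` whose full `L`-function
`D.L` agrees on `Re s > 1` with an entire `g` (`HasEntireContinuation`, as delivered by the named
fact `godementJacquet`), `S` a finite set of places and `γ` an honest Satake family of `Π` off `S`.
Then `L^S(s, γ)` extends to an entire function: the exceptional places `D.S` of the datum are
genuinely ramified, hence in `S`; on `Re s > 1`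
`D.L = (∏_{v ∈ D.S} P_v(q_v^{-s})⁻¹) · L^{D.S}(D.α)` (`L_eq_partialStandardL_mul_of_summable`, by
Jacquet–Shalika's (5.3.3) `summable_normSq_trace_satakePow_holds`),
`L^{D.S}(D.α) = (∏_{v ∈ S ∖ D.S} det(1 - t_v q_v^{-s})⁻¹) · L^S(D.α)` and `L^S(D.α) = L^S(γ)`
(uniqueness of Hecke–Satake parameters), so `L^S(γ) = F · g` with
`F = ∏_{v ∈ D.S} P_v(q_v^{-s}) ∏_{v ∈ S ∖ D.S} det(1 - t_v q_v^{-s})` wherever `F ≠ 0`; `F` is entire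
and `F(x) → 1` as `x → +∞` (`P_v(0) = 1`), so its zeros are isolated, and both sides being
continuous on `Re s > 1` (`differentiableOn_partialStandardL_of_summable`) the identity holds on
the whole half-plane. (Neukirch VII §8: `L`-series differing by finitely many Euler factors.) This
strengthens `StandardLFunctionData.exists_entire_eq_partialStandardL_of_hasEntireContinuation` of
`LanglandsTunnellBridgeL2` (agreement far to the right only) to the full half-plane `Re s > 1`,
(5.3.3) being now a theorem. [cite: GodementJacquet1972, Thm. 13.8] -/
theorem StandardLFunctionData.hasEntireContinuation_partialStandardL
    {P : CuspidalAutomorphicRepGL n K μ} (D : StandardLFunctionData P)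
    (hD : GaloisRepresentations.LFunction.HasEntireContinuation D.L)
    {S : Set (HeightOneSpectrum (𝓞 K))} (hS : S.Finite) {γ : SatakeFamily K}
    (hγ : IsSatakeFamilyOf P S γ) :
    GaloisRepresentations.LFunction.HasEntireContinuation (partialStandardL S γ) := by
  classical
  have h₂ := summable_normSq_trace_satakePow_holds (n := n) (K := K) (μ := μ)
  obtain ⟨g, hg, hgL⟩ := hD
  -- `D.S ⊆ S`
  have hDS : (↑D.S : Set (HeightOneSpectrum (𝓞 K))) ⊆ S := fun v hv => by
    by_contra hvS
    exact D.not_isUnramifiedAt v (Finset.mem_coe.mp hv) (hγ.isUnramifiedAt hvS)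
  have hfin : (S \ ↑D.S).Finite := hS.subset fun v hv => hv.1
  have hq0 : ∀ v : HeightOneSpectrum (𝓞 K), ((v.residueCard : ℕ) : ℂ) ≠ 0 := fun v =>
    Nat.cast_ne_zero.mpr (zero_lt_one.trans v.one_lt_residueCard).ne'
  -- the finite product of exceptional and of moved unramified inverse factors
  set F : ℂ → ℂ := fun s =>
    (∏ v ∈ D.S, (D.localFactor v).eval ((v.residueCard : ℂ) ^ (-s))) *
      ∏ v ∈ hfin.toFinset, (eulerPolynomial (D.α v)).eval ((v.residueCard : ℂ) ^ (-s)) with hF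
  have hFd : Differentiable ℂ F := by
    refine (Differentiable.fun_finsetProd fun v _ => ?_).mul
      (Differentiable.fun_finsetProd fun v _ => ?_)
    · exact (D.localFactor v).differentiable.comp
        (differentiable_id.neg.const_cpow (Or.inl (hq0 v)))
    · exact (eulerPolynomial (D.α v)).differentiable.comp
        (differentiable_id.neg.const_cpow (Or.inl (hq0 v)))
  -- on `Re s > 1`, off the zeros of `F`: `F · g = L^S(γ)`
  have hLS : ∀ s : ℂ, 1 < s.re → F s ≠ 0 → F s * g s = partialStandardL S γ s := by
    intro s hs hFs
    have hA : ∏ v ∈ D.S, (D.localFactor v).eval ((v.residueCard : ℂ) ^ (-s)) ≠ 0 :=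
      left_ne_zero_of_mul hFs
    have hB : ∏ v ∈ hfin.toFinset, (eulerPolynomial (D.α v)).eval ((v.residueCard : ℂ) ^ (-s)) ≠ 0 :=
      right_ne_zero_of_mul hFs
    have hL := StandardLFunctionData.L_eq_partialStandardL_mul_of_summable h₂ D hs
    have hmulS : Multipliable fun v : {v : HeightOneSpectrum (𝓞 K) // v ∉ S} =>
        ((satakePairPolynomial (D.α v.1) {1}).eval ((v.1.residueCard : ℂ) ^ (-s)))⁻¹ := by
      simpa only [satakePairPolynomial_one_right] using
        multipliable_partialStandardL_of_summable h₂ P (D.isSatakeFamily.mono hDS) hs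
    have hsplit : partialStandardL ↑D.S D.α s =
        (∏ v ∈ hfin.toFinset, ((eulerPolynomial (D.α v)).eval ((v.residueCard : ℂ) ^ (-s)))⁻¹) *
          partialStandardL S γ s := by
      rw [partialStandardL_eq_of_isSatakeFamilyOf (T := S) subset_rfl hDS hγ D.isSatakeFamily,
        partialStandardL_eq_partialPairL_one, partialStandardL_eq_partialPairL_one,
        partialPairL_eq_prod_mul_partialPairL hDS hfin D.α (fun _ => {1}) hmulS]
      simp only [satakePairPolynomial_one_right]
    rw [hgL s hs, hL, hsplit, Finset.prod_inv_distrib, Finset.prod_inv_distrib]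
    simp only [hF]
    field_simp
  -- `F` is not identically zero: `F(x) ≠ 0` for large real `x`
  have hF₀ : ∃ s₁ : ℂ, F s₁ ≠ 0 := by
    have ht : ∀ v : HeightOneSpectrum (𝓞 K),
        Tendsto (fun x : ℝ => (v.residueCard : ℂ) ^ (-(x : ℂ))) atTop (𝓝 0) := fun v => by
      have hq1 : (1 : ℝ) < (v.residueCard : ℝ) := by exact_mod_cast v.one_lt_residueCard
      rw [tendsto_zero_iff_norm_tendsto_zero]
      have heq : (fun x : ℝ => ‖(v.residueCard : ℂ) ^ (-(x : ℂ))‖) =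
          fun x : ℝ => (v.residueCard : ℝ) ^ (-x) := by
        funext x
        rw [Complex.norm_natCast_cpow_of_pos (zero_lt_one.trans v.one_lt_residueCard),
          Complex.neg_re, Complex.ofReal_re]
      rw [heq]
      exact (tendsto_rpow_atBot_of_base_gt_one _ hq1).comp tendsto_neg_atTop_atBot
    have hvA : ∀ v ∈ D.S, ∀ᶠ x : ℝ in atTop,
        (D.localFactor v).eval ((v.residueCard : ℂ) ^ (-(x : ℂ))) ≠ 0 := fun v _ =>
      (ht v).eventually ((D.localFactor v).continuous.continuousAt.eventually_ne
        (by rw [D.eval_zero_localFactor]; exact one_ne_zero))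
    have hvB : ∀ v ∈ hfin.toFinset, ∀ᶠ x : ℝ in atTop,
        (eulerPolynomial (D.α v)).eval ((v.residueCard : ℂ) ^ (-(x : ℂ))) ≠ 0 := fun v _ =>
      (ht v).eventually ((eulerPolynomial (D.α v)).continuous.continuousAt.eventually_ne
        (by rw [eval_zero_eulerPolynomial]; exact one_ne_zero))
    obtain ⟨x, hxA, hxB⟩ :=
      (((eventually_all_finset D.S).mpr hvA).and ((eventually_all_finset _).mpr hvB)).exists
    exact ⟨(x : ℂ), mul_ne_zero (Finset.prod_ne_zero_iff.mpr fun v hv' => hxA v hv')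
      (Finset.prod_ne_zero_iff.mpr fun v hv' => hxB v hv')⟩
  -- hence its zeros are isolated
  have hFev : ∀ s₀ : ℂ, ∀ᶠ s in 𝓝[≠] s₀, F s ≠ 0 := fun s₀ => by
    obtain ⟨s₁, hs₁⟩ := hF₀
    have hmer : MeromorphicOn F Set.univ := fun s _ => (hFd.analyticAt s).meromorphicAt
    have h₁ : meromorphicOrderAt F s₁ ≠ ⊤ := by
      rw [meromorphicOrderAt_ne_top_iff_eventually_ne_zero (hmer s₁ (Set.mem_univ _))]
      exact eventually_nhdsWithin_of_eventually_nhds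
        ((hFd.continuous.continuousAt).eventually_ne hs₁)
    have h₀ : meromorphicOrderAt F s₀ ≠ ⊤ :=
      hmer.meromorphicOrderAt_ne_top_of_isPreconnected isPreconnected_univ (Set.mem_univ s₁)
        (Set.mem_univ s₀) h₁
    exact (meromorphicOrderAt_ne_top_iff_eventually_ne_zero (hmer s₀ (Set.mem_univ _))).mp h₀
  -- the entire function `F · g` agrees with `L^S(γ)` on all of `Re s > 1` (continuity)
  refine ⟨fun s => F s * g s, hFd.mul hg, fun s₀ hs₀ => ?_⟩
  have hUo : IsOpen {s : ℂ | 1 < s.re} := isOpen_lt continuous_const Complex.continuous_re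
  have hcontL : ContinuousAt (partialStandardL S γ) s₀ :=
    ((differentiableOn_partialStandardL_of_summable h₂ P hγ).differentiableAt
      (hUo.mem_nhds hs₀)).continuousAt
  have hcontG : ContinuousAt (fun s => F s * g s) s₀ := (hFd.mul hg).continuous.continuousAt
  have hev : ∀ᶠ s in 𝓝[≠] s₀, F s * g s = partialStandardL S γ s := by
    have h1 : ∀ᶠ s in 𝓝[≠] s₀, 1 < s.re :=
      eventually_nhdsWithin_of_eventually_nhds (hUo.mem_nhds hs₀)
    filter_upwards [hFev s₀, h1] with s hFs hs using hLS s hs hFs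
  exact tendsto_nhds_unique ((hcontG.tendsto.mono_left nhdsWithin_le_nhds).congr' hev)
    (hcontL.tendsto.mono_left nhdsWithin_le_nhds)

/-- **Partial standard `L`-functions of cuspidal representations of `GL_n`, `n ≥ 2`, are entire,
granted `godementJacquet`** (LNM 260, Thm. 13.8 in the tree's existence form, lang.S21): for every
cuspidal `Π` of `GL_n(𝔸_K)`, every finite `S` and every honest Satake family `γ` of `Π` off `S`,
`L^S(s, Π) = partialStandardL S γ` extends from `Re s > 1` to an entire function
(`StandardLFunctionData.hasEntireContinuation_partialStandardL` on the datum of `godementJacquet`).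
The entire analogue of `hasMeromorphicContinuation_partialStandardL_of_godementJacquet` of
`AutomorphicLFunctionsProofs`, now free of the inputs (F), (JS) discharged since.
[cite: GodementJacquet1972, Thm. 13.8] -/
theorem hasEntireContinuation_partialStandardL_of_godementJacquet
    (hGJ : godementJacquet (n := n) (K := K) (μ := μ)) {P : CuspidalAutomorphicRepGL n K μ}
    (hP : 2 ≤ n ∨ ¬ P.1.IsTrivialSubrep) {S : Set (HeightOneSpectrum (𝓞 K))} (hS : S.Finite)
    {γ : SatakeFamily K} (hγ : IsSatakeFamilyOf P S γ) :
    GaloisRepresentations.LFunction.HasEntireContinuation (partialStandardL S γ) := by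
  obtain ⟨D, hD, -⟩ := hGJ P hP
  exact D.hasEntireContinuation_partialStandardL hD hS hγ

end Standard

/-! ### Corollaire (i)(a) for `GL_n × GL_1` and `GL_1 × GL_n` from `godementJacquet` -/

section RankOne

variable {n : ℕ} {K : Type} [Field K] [NumberField K]
  {μ : Measure (gl n K).automorphicQuotient} [(gl n K).IsAutomorphicMeasure μ]
  {μ₁ : Measure (gl 1 K).automorphicQuotient} [(gl 1 K).IsAutomorphicMeasure μ₁]

/-- **Mœglin–Waldspurger, Corollaire (i)(a) for `GL_n × GL_1` from Godement–Jacquet.** Granted the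
named fact `godementJacquet` at `GL_n` (LNM 260, Thm. 13.8: entire continuation of `L(s, Π)` for
cuspidal `Π` of `GL_n(𝔸_K)`, `n ≥ 2`), the named fact
`MoeglinWaldspurger1989_partialPairL_entire_of_rank_ne` holds at `(n, 1)`: for cuspidal `π` of
`GL_n(𝔸_K)` (`n ≠ 1`, `n ≥ 1`, so `n ≥ 2`) and `σ = χ` of `GL_1(𝔸_K)` with Satake families `α`,
`β` off a finite `S`, `L^S(s, π ⊗ χ) = L^S(s, π ⊗ χ)` is the partial standard `L`-function of the
twist `π ⊗ χ` (`partialPairL_eq_partialStandardL_twist`; its Satake family `χ(ϖ_v) t_{π,v}` off `S`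
is honest, `IsSatakeFamilyOf.twistByChar_of_isUnramifiedAt`, `χ` being unramified off `S`,
`IsSatakeFamilyOf.isUnramifiedAt_heckeCharacter`), which extends to an entire function by
`hasEntireContinuation_partialStandardL_of_godementJacquet` for `π ⊗ χ`.
[cite: MoeglinWaldspurger1989, Appendice, Corollaire (i)(a), p. 667]
[cite: GodementJacquet1972, Thm. 13.8] -/
theorem MoeglinWaldspurger1989_partialPairL_entire_of_rank_ne_gl_one_of_godementJacquet
    (hGJ : godementJacquet (n := n) (K := K) (μ := μ)) :
    MoeglinWaldspurger1989_partialPairL_entire_of_rank_ne (n := n) (m := 1) (K := K) (μ := μ)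
      (μ' := μ₁) := by
  intro hn1 hn _ P P' S hS α β hα hβ
  have hn2 : 2 ≤ n := by omega
  have hγ := hα.twistByChar_of_isUnramifiedAt P'.heckeCharacter P'.isUnitary_heckeCharacter
    P'.heckeCharacter_posRealIdele (fun v hv => hβ.isUnramifiedAt_heckeCharacter hv)
  obtain ⟨G, hG, hGL⟩ := hasEntireContinuation_partialStandardL_of_godementJacquet hGJ (Or.inl hn2) hS hγ
  refine ⟨G, hG, fun s hs => ?_⟩
  rw [hGL s hs, partialPairL_eq_partialStandardL_twist hβ α]

/-- **Corollaire (i)(a) for `GL_1 × GL_n` from Godement–Jacquet** (the previous theorem and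
`L^S(s, β ⊗ α) = L^S(s, α ⊗ β)`, `partialPairL_comm`).
[cite: MoeglinWaldspurger1989, Appendice, Corollaire (i)(a), p. 667]
[cite: GodementJacquet1972, Thm. 13.8] -/
theorem MoeglinWaldspurger1989_partialPairL_entire_of_rank_ne_one_gl_of_godementJacquet
    (hGJ : godementJacquet (n := n) (K := K) (μ := μ)) :
    MoeglinWaldspurger1989_partialPairL_entire_of_rank_ne (n := 1) (m := n) (K := K) (μ := μ₁)
      (μ' := μ) := by
  intro h1n h1 hn P' P S hS β α hβ hα
  rw [partialPairL_comm S β α]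
  exact MoeglinWaldspurger1989_partialPairL_entire_of_rank_ne_gl_one_of_godementJacquet hGJ
    (Ne.symm h1n) hn h1 P P' hS hα hβ

variable {μ₂ : Measure (gl 2 K).automorphicQuotient} [(gl 2 K).IsAutomorphicMeasure μ₂]

/-- **`GL₂ × GL₁`: Corollaire (i)(a) from `godementJacquet` at `GL₂`** — the smallest case of the
named fact, whose only input beyond the tree's theorems is the entire continuation of the standard
`L`-functions of cuspidal representations of `GL₂(𝔸_K)` (Jacquet–Langlands (1970), Thm. 11.1, in the
form `godementJacquet (n := 2)`). [cite: MoeglinWaldspurger1989, Appendice, Corollaire (i)(a), p. 667]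
[cite: GodementJacquet1972, Thm. 13.8] -/
theorem MoeglinWaldspurger1989_partialPairL_entire_of_rank_ne_two_one_of_godementJacquet
    (hGJ : godementJacquet (n := 2) (K := K) (μ := μ₂)) :
    MoeglinWaldspurger1989_partialPairL_entire_of_rank_ne (n := 2) (m := 1) (K := K) (μ := μ₂)
      (μ' := μ₁) :=
  MoeglinWaldspurger1989_partialPairL_entire_of_rank_ne_gl_one_of_godementJacquet hGJ

/-- **`GL₁ × GL₂`: Corollaire (i)(a) from `godementJacquet` at `GL₂`.**
[cite: MoeglinWaldspurger1989, Appendice, Corollaire (i)(a), p. 667] [cite: GodementJacquet1972, Thm. 13.8] -/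
theorem MoeglinWaldspurger1989_partialPairL_entire_of_rank_ne_one_two_of_godementJacquet
    (hGJ : godementJacquet (n := 2) (K := K) (μ := μ₂)) :
    MoeglinWaldspurger1989_partialPairL_entire_of_rank_ne (n := 1) (m := 2) (K := K) (μ := μ₁)
      (μ' := μ₂) :=
  MoeglinWaldspurger1989_partialPairL_entire_of_rank_ne_one_gl_of_godementJacquet hGJ

end RankOne


/-! ### Arthur–Clozel (2.2) for `GL_n × GL_1` from Godement–Jacquet and the equal-rank facts -/

section Boundary

variable {n : ℕ} {K : Type} [Field K] [NumberField K]
  {μ : Measure (gl n K).automorphicQuotient} [(gl n K).IsAutomorphicMeasure μ]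
  {μ₁ : Measure (gl 1 K).automorphicQuotient} [(gl 1 K).IsAutomorphicMeasure μ₁]

/-- **Arthur–Clozel (2.2) at `s = 1` for `GL_n × GL_1` from Godement–Jacquet and Corollaire (ii)
at `GL_n`.** For cuspidal `π` of `GL_n(𝔸_K)`, `n ≥ 2`, and idele class characters `χ`,
`L^S(s, π ⊗ χ) → c ≠ 0` as `s → 1`, `Re s > 1` (the named fact
`JacquetShalika1981_partialPairL_at_one_of_rank_ne` at `(n, 1)`), granted `godementJacquet` at `GL_n`
(for Corollaire (i)(a) at `(n, 1)`, `…_gl_one_of_godementJacquet`) and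
`MoeglinWaldspurger1989_partialPairL_of_eq_conj` at `GL_n` (Corollaire (ii); at `GL_1` it is the
theorem `MoeglinWaldspurger1989_partialPairL_of_eq_conj_one`): de la Vallée Poussin's positivity with
Landau's lemma, `JacquetShalika1981_partialPairL_at_one_of_rank_ne_of_moeglinWaldspurger`. In print the
non-vanishing half is Jacquet–Shalika (1976), `L(1, π ⊗ χ) ≠ 0`.
[cite: ArthurClozelAMS120, Ch. 3 §2 (2.2)] [cite: GodementJacquet1972, Thm. 13.8]
[cite: MoeglinWaldspurger1989, Appendice, Corollaire (ii), p. 667] -/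
theorem JacquetShalika1981_partialPairL_at_one_of_rank_ne_gl_one_of_godementJacquet_of_MW
    (hGJ : godementJacquet (n := n) (K := K) (μ := μ))
    (h₂ : MoeglinWaldspurger1989_partialPairL_of_eq_conj (n := n) (K := K) (μ := μ)) :
    JacquetShalika1981_partialPairL_at_one_of_rank_ne (n := n) (m := 1) (K := K) (μ := μ)
      (μ' := μ₁) :=
  JacquetShalika1981_partialPairL_at_one_of_rank_ne_of_moeglinWaldspurger
    (MoeglinWaldspurger1989_partialPairL_entire_of_rank_ne_gl_one_of_godementJacquet hGJ) h₂
    MoeglinWaldspurger1989_partialPairL_of_eq_conj_one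

/-- **Arthur–Clozel (2.2) at `s = 1` for `GL_1 × GL_n`** from the same inputs
(`JacquetShalika1981_partialPairL_at_one_of_rank_ne_of_moeglinWaldspurger` at `(1, n)`).
[cite: ArthurClozelAMS120, Ch. 3 §2 (2.2)] [cite: GodementJacquet1972, Thm. 13.8] -/
theorem JacquetShalika1981_partialPairL_at_one_of_rank_ne_one_gl_of_godementJacquet_of_MW
    (hGJ : godementJacquet (n := n) (K := K) (μ := μ))
    (h₂ : MoeglinWaldspurger1989_partialPairL_of_eq_conj (n := n) (K := K) (μ := μ)) :
    JacquetShalika1981_partialPairL_at_one_of_rank_ne (n := 1) (m := n) (K := K) (μ := μ₁)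
      (μ' := μ) :=
  JacquetShalika1981_partialPairL_at_one_of_rank_ne_of_moeglinWaldspurger
    (MoeglinWaldspurger1989_partialPairL_entire_of_rank_ne_one_gl_of_godementJacquet hGJ)
    MoeglinWaldspurger1989_partialPairL_of_eq_conj_one h₂

/-- **Arthur–Clozel (2.2) off `s = 1` for `GL_n × GL_1`, `n ≥ 2`, from Godement–Jacquet,
Corollaire (i)(b), (ii) and multiplicity one at `GL_n`** (the named fact
`JacquetShalika1981_partialPairL_boundary_of_ne_one` at `(n, 1)`;
`JacquetShalika1981_partialPairL_boundary_of_ne_one_of_MW_of_rank_one` of `PairLFunctionBoundarySelfDual`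
with Corollaire (i)(a) at `(n, 1)` supplied by `godementJacquet`, and (ii) at `GL_1` by the theorem
`MoeglinWaldspurger1989_partialPairL_of_eq_conj_one`).
[cite: ArthurClozelAMS120, Ch. 3 §2 (2.2)] [cite: GodementJacquet1972, Thm. 13.8]
[cite: MoeglinWaldspurger1989, Appendice, Corollaire, p. 667] -/
theorem JacquetShalika1981_partialPairL_boundary_of_ne_one_gl_one_of_godementJacquet_of_MW
    (hGJ : godementJacquet (n := n) (K := K) (μ := μ))
    (h₂ : MoeglinWaldspurger1989_partialPairL_entire_of_ne_conj (n := n) (K := K) (μ := μ))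
    (h₃ : MoeglinWaldspurger1989_partialPairL_of_eq_conj (n := n) (K := K) (μ := μ))
    (hm1 : Literature.NumberTheory.Automorphic.multiplicity_one_gl n K μ) (hn1 : n ≠ 1) :
    JacquetShalika1981_partialPairL_boundary_of_ne_one (n := n) (m := 1) (K := K) (μ := μ)
      (μ' := μ₁) :=
  JacquetShalika1981_partialPairL_boundary_of_ne_one_of_MW_of_rank_one
    (MoeglinWaldspurger1989_partialPairL_entire_of_rank_ne_gl_one_of_godementJacquet hGJ) h₂ h₃
    MoeglinWaldspurger1989_partialPairL_of_eq_conj_one hm1 hn1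

/-- **Arthur–Clozel (2.2) off `s = 1` for `GL_1 × GL_n`, `n ≥ 2`**, from the same inputs
(`JacquetShalika1981_partialPairL_boundary_of_ne_one_of_MW_of_rank_one_left`).
[cite: ArthurClozelAMS120, Ch. 3 §2 (2.2)] [cite: GodementJacquet1972, Thm. 13.8] -/
theorem JacquetShalika1981_partialPairL_boundary_of_ne_one_one_gl_of_godementJacquet_of_MW
    (hGJ : godementJacquet (n := n) (K := K) (μ := μ))
    (h₂ : MoeglinWaldspurger1989_partialPairL_entire_of_ne_conj (n := n) (K := K) (μ := μ))
    (h₃ : MoeglinWaldspurger1989_partialPairL_of_eq_conj (n := n) (K := K) (μ := μ))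
    (hm1 : Literature.NumberTheory.Automorphic.multiplicity_one_gl n K μ) (hn1 : n ≠ 1) :
    JacquetShalika1981_partialPairL_boundary_of_ne_one (n := 1) (m := n) (K := K) (μ := μ₁)
      (μ' := μ) :=
  JacquetShalika1981_partialPairL_boundary_of_ne_one_of_MW_of_rank_one_left
    (MoeglinWaldspurger1989_partialPairL_entire_of_rank_ne_gl_one_of_godementJacquet hGJ) h₂ h₃
    MoeglinWaldspurger1989_partialPairL_of_eq_conj_one hm1 hn1

end Boundary


/-! ### The `(n, 1)` slice of Corollaire (i)(a) is the entireness of partial standard `L`-functions -/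

section Standard'

variable {n : ℕ} {K : Type} [Field K] [NumberField K]
  {μ : Measure (gl n K).automorphicQuotient} [(gl n K).IsAutomorphicMeasure μ]
  {μ₁ : Measure (gl 1 K).automorphicQuotient} [(gl 1 K).IsAutomorphicMeasure μ₁]

omit [(gl n K).IsAutomorphicMeasure μ] in
/-- **The trivial representation of `GL_1(𝔸_K)` and its Satake family.** In `L²_cusp(GL_1)` there
is a cuspidal `𝟙` with Hecke character `χ_𝟙 = 1` (`CuspidalAutomorphicRepGL.exists_heckeCharacter_eq`,
the constants), unramified everywhere with honest Satake family `v ↦ {1}` off `S = ∅`: it has a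
non-zero vector fixed by the full level `K(1)`, and a fixed vector of a line is a Hecke eigenvector
at every place with parameter `{χ_𝟙(⟨ϖ_v⟩_v)} = {1}`
(`GLOne.hasSatakeParameterAt_of_mem_fixedVectors`). [folklore] -/
theorem exists_cuspidalAutomorphicRepGL_one_isSatakeFamilyOf_one :
    ∃ P₁ : CuspidalAutomorphicRepGL 1 K μ₁, P₁.heckeCharacter = 1 ∧
      IsSatakeFamilyOf P₁ ∅ fun _ => {1} := by
  obtain ⟨P₁, h1, hfix⟩ := CuspidalAutomorphicRepGL.exists_heckeCharacter_eq (μ := μ₁)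
    (1 : Literature.NumberTheory.GaloisRepresentations.HeckeCharacter K)
    Literature.NumberTheory.GaloisRepresentations.HeckeCharacter.isUnitary_one (fun _ => rfl)
  obtain ⟨f, hf, hf0⟩ := hfix (principalCongruenceLevel 1 K ⊤) fun _ _ => rfl
  refine ⟨P₁, h1, fun v _ => ⟨⊤, top_ne_bot, fun hd => v.isPrime.ne_top ?_,
    Literature.NumberTheory.GaloisRepresentations.HeckeCharacter.uniformizer K v, ?_⟩⟩
  · exact Ideal.eq_top_of_isUnit_mem _ (Ideal.le_of_dvd hd trivial) isUnit_one
  · have key := GLOne.hasSatakeParameterAt_of_mem_fixedVectors P₁.isTopIrreducible hf hf0 v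
      (Literature.NumberTheory.GaloisRepresentations.HeckeCharacter.valued_uniformizer v)
    have hval : ((GLOne.heckeCharacter P₁.isTopIrreducible
        (Literature.NumberTheory.GaloisRepresentations.localUnits v
          (Literature.NumberTheory.GaloisRepresentations.HeckeCharacter.uniformizer K v)) : ℂˣ) : ℂ)
        = 1 := by
      change ((P₁.heckeCharacter _ : ℂˣ) : ℂ) = 1
      rw [h1, Literature.NumberTheory.GaloisRepresentations.HeckeCharacter.one_apply, Units.val_one]
    rwa [hval] at key

/-- **Corollaire (i)(a) at `(n, 1)` from the entireness of the partial standard `L`-functions at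
`GL_n`.** If for every cuspidal `Π` of `GL_n(𝔸_K)` (in `L²(μ)`), every finite `S` and every honest
Satake family `γ` of `Π` off `S` the partial standard `L`-function `L^S(s, Π)` extends to an entire
function, then `MoeglinWaldspurger1989_partialPairL_entire_of_rank_ne` holds at `(n, 1)`:
`L^S(s, π ⊗ χ) = L^S(s, π ⊗ χ)` for the twist (`partialPairL_eq_partialStandardL_twist`,
`IsSatakeFamilyOf.twistByChar_of_isUnramifiedAt`). The theorem `…_gl_one_of_godementJacquet` is the
case where the hypothesis is supplied by `godementJacquet`.
[cite: MoeglinWaldspurger1989, Appendice, Corollaire (i)(a), p. 667] [cite: ArthurClozelAMS120, Ch. 3, p. 172] -/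
theorem MoeglinWaldspurger1989_partialPairL_entire_of_rank_ne_gl_one_of_standard
    (hstd : ∀ (Q : CuspidalAutomorphicRepGL n K μ) {S : Set (HeightOneSpectrum (𝓞 K))}
      (_hS : S.Finite) {γ : SatakeFamily K} (_hγ : IsSatakeFamilyOf Q S γ),
      GaloisRepresentations.LFunction.HasEntireContinuation (partialStandardL S γ)) :
    MoeglinWaldspurger1989_partialPairL_entire_of_rank_ne (n := n) (m := 1) (K := K) (μ := μ)
      (μ' := μ₁) := by
  intro _ _ _ P P' S hS α β hα hβ
  have hγ := hα.twistByChar_of_isUnramifiedAt P'.heckeCharacter P'.isUnitary_heckeCharacter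
    P'.heckeCharacter_posRealIdele (fun v hv => hβ.isUnramifiedAt_heckeCharacter hv)
  obtain ⟨G, hG, hGL⟩ := hstd _ hS hγ
  refine ⟨G, hG, fun s hs => ?_⟩
  rw [hGL s hs, partialPairL_eq_partialStandardL_twist hβ α]

/-- **Conversely, Corollaire (i)(a) at `(n, 1)` makes every partial standard `L`-function of
`GL_n` entire** (`n ≥ 2`): pair `Π` with the trivial representation `𝟙` of `GL_1(𝔸_K)`, whose
honest Satake family is `{1}` (`exists_cuspidalAutomorphicRepGL_one_isSatakeFamilyOf_one`), and
`L^S(s, Π × 𝟙) = L^S(s, Π)` (`partialStandardL_eq_partialPairL_one`). Thus the `(n, 1)` slice of the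
named fact is exactly the entireness of the partial Godement–Jacquet `L`-functions of the cuspidal
spectrum of `GL_n`. [cite: MoeglinWaldspurger1989, Appendice, Corollaire (i)(a), p. 667]
[cite: GodementJacquet1972, Thm. 13.8] -/
theorem hasEntireContinuation_partialStandardL_of_MW_rank_ne_gl_one (hn : 2 ≤ n)
    (h₁ : MoeglinWaldspurger1989_partialPairL_entire_of_rank_ne (n := n) (m := 1) (K := K) (μ := μ)
      (μ' := μ₁))
    (P : CuspidalAutomorphicRepGL n K μ) {S : Set (HeightOneSpectrum (𝓞 K))} (hS : S.Finite)
    {γ : SatakeFamily K} (hγ : IsSatakeFamilyOf P S γ) :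
    GaloisRepresentations.LFunction.HasEntireContinuation (partialStandardL S γ) := by
  obtain ⟨P₁, -, hβ₁⟩ := exists_cuspidalAutomorphicRepGL_one_isSatakeFamilyOf_one (μ₁ := μ₁) (K := K)
  obtain ⟨g, hg, hgL⟩ := h₁ (by omega) (by omega) one_pos P P₁ hS hγ (hβ₁.mono (Set.empty_subset S))
  refine ⟨g, hg, fun s hs => ?_⟩
  rw [hgL s hs, partialStandardL_eq_partialPairL_one]

/-- **The `(n, 1)` slice of Corollaire (i)(a) ⟺ entireness of the partial standard
`L`-functions of cuspidal representations of `GL_n(𝔸_K)`** (`n ≥ 2`; for any auxiliary automorphic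
measure on `GL_1`). [cite: MoeglinWaldspurger1989, Appendice, Corollaire (i)(a), p. 667]
[cite: GodementJacquet1972, Thm. 13.8] -/
theorem MoeglinWaldspurger1989_partialPairL_entire_of_rank_ne_gl_one_iff_standard (hn : 2 ≤ n) :
    MoeglinWaldspurger1989_partialPairL_entire_of_rank_ne (n := n) (m := 1) (K := K) (μ := μ)
      (μ' := μ₁) ↔
    ∀ (Q : CuspidalAutomorphicRepGL n K μ) {S : Set (HeightOneSpectrum (𝓞 K))}
      (_hS : S.Finite) {γ : SatakeFamily K} (_hγ : IsSatakeFamilyOf Q S γ),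
      GaloisRepresentations.LFunction.HasEntireContinuation (partialStandardL S γ) :=
  ⟨fun h₁ Q _ hS _ hγ => hasEntireContinuation_partialStandardL_of_MW_rank_ne_gl_one hn h₁ Q hS hγ,
    MoeglinWaldspurger1989_partialPairL_entire_of_rank_ne_gl_one_of_standard⟩

end Standard'

end Literature.NumberTheory.Automorphic
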